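import Literature.Computability.Cryptography.ShorAssembly
import Literature.Computability.QuantumComplexity.PadDecider
import Literature.Computability.QuantumComplexity.SubroutineUniform
import HarnessLib

/-!
# `BQP^BQP = BQP` for search problems: the discharge of `isQSolvable_of_mem_BQP_oracle`

Bennett–Bernstein–Brassard–Vazirani 1997, Cor. 4.15 (`BQP^BQP = BQP`, stated there without proof as a
consequence of Thm. 4.13 — boosting — and Thm. 4.14 — tidy subroutines: run, copy the answer,
reverse), in the form vendored in `ShorAssembly.lean`: a polynomial-time uniform Clifford+T family
with oracle gates for a language `A ∈ BQP`, solving an extension-closed relation `R` with probability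
`≥ 2/3 + δ`, yields `IsQSolvable R`. The proof assembles the series

* `PolyCopies.lean`, `PolyMajority.lean` — Thm. 4.13 with polynomially many copies: every `A ∈ BQP`
  has a uniform family with error `≤ 1/(4(n+1)²)`;
* `PadDecider.lean` — deciders of the queries of length `k` with error
  `≤ 1/(r+1)²`, uniform in `⟨1^k, 1^r⟩` (`exists_uniform_deciderFamily`);
* `TidyBlock.lean`, `BQPSubroutine.lean`, `SubroutineUniform.lean` (Part A) — Thm. 4.14: the tidy block of a decider
  implements the oracle gate up to `2/(r+1)` in operator norm on ancilla-clean inputs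
  (`DeciderFamily.tidy_implements`) and is uniform (`DeciderFamily.tidy_isUniform`);
* `OracleSubstitution.lean`, `SubroutineUniform.lean` (Part B) — Cor. 4.15: substituting the blocks for the oracle
  gates costs `T · ε` in success probability (`kernelProb_substFamily_ge`) and keeps uniformity
  (`substFamily_isUniform`); `isQSolvable_of_tidyFamily` chooses the precision polynomial.

## References

* C. H. Bennett, E. Bernstein, G. Brassard, U. Vazirani, *Strengths and weaknesses of quantum
  computing*, SIAM J. Comput. 26 (1997) 1510–1523, Thm. 4.13, Thm. 4.14, Cor. 4.15
  [BennettBernsteinBrassardVazirani1997].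
-/

namespace Literature.Computability.Cryptography

open QuantumComplexity

/-- **`BQP^BQP = BQP` for search problems** (Bennett–Bernstein–Brassard–Vazirani 1997, Cor. 4.15 with
Thms. 4.13–4.14): the discharge of the named fact `isQSolvable_of_mem_BQP_oracle`.
[cite: BennettBernsteinBrassardVazirani1997, Cor. 4.15 (with Thm. 4.13 and Thm. 4.14)] -/
theorem isQSolvable_of_mem_BQP_oracle_holds : isQSolvable_of_mem_BQP_oracle := by
  intro A R F δ hR hA hF hδ hk
  obtain ⟨D, hDU, hDfree, hDdec⟩ := exists_uniform_deciderFamily hA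
  exact isQSolvable_of_tidyFamily D.tidy 2 (by norm_num)
    (fun q => substFamily_isUniform q hF (DeciderFamily.tidy_isUniform hDU hDfree))
    (D.tidy_implements hDfree hDdec) hR hF hδ hk

end Literature.Computability.Cryptography
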